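import Mathlib.MeasureTheory.Integral.IntervalIntegral.Basic
import Mathlib.MeasureTheory.Function.LpSeminorm.Basic
import Literature.Analysis.FluidPDE.PassiveScalar
import Literature.Analysis.FluidPDE.PassiveScalarEnergyProofs
import Literature.Analysis.FunctionSpaces.SpaceTimeWeakCompactness
import HarnessLib

/-!
# Distributional versus parabolic solutions of advection–diffusion equations with rough drift
  (Bonicatto–Ciampa–Crippa, J. Evol. Equ. 24 (2024), §2–§3: Def. 2.3, Prop. 2.4, Thm. 2.7,
  Thm. 3.3, Cor. 3.5 — faithful statements)

Topic `Analysis/FluidPDE`; the well-posedness companion of `PassiveScalar.lean` (whose weak class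
`Torus.IsWeakScalarTransportOn T κ b θ₀ θ` — `θ ∈ L^∞_t L²_x`, `b ∈ L¹_t L²_x` weakly divergence free,
`bθ ∈ L¹`, smooth tests compactly supported in `[0,T) × T^d` — IS the source's Definition 2.1 of a
distributional solution at `p = q = 2`, with a diffusivity `κ`), of `PassiveScalarUniquenessL1Sobolev.lean`
(DiPerna–Lions uniqueness for `L¹_t Ḣ¹_x` drifts) and of `PassiveScalarEnergyProofs.lean` (which PROVES the
source's Thm. 3.3 in the corner `p = ∞`, `q = 2`: `IsWeakScalarTransportOn.energy_ineq_holds`). Vocabulary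
`Torus.IsWeakScalarTransportOn`, `Torus.eScalarGradNormSq`, `Torus.eScalarDissipation`, `stLift` reused,
never redeclared.

P. Bonicatto, G. Ciampa, G. Crippa, *Weak and parabolic solutions of advection–diffusion equations with
rough velocity field*, J. Evol. Equ. 24 (2024) no. 1, Paper 1 (doi:10.1007/s00028-023-00919-6) =
arXiv:2306.15529 (held as `paper:arxiv-2306.15529`, TeX-source render, statements checked on it
2026-08-27): §2 "Distributional and parabolic solutions" — (2.1) the Cauchy problem
`∂ₜu + div(b u) = Δu` on `(0,T) × T^d`, `u|_{t=0} = u₀`; **Definition 2.1** (distributional solution: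
`b ∈ L¹([0,T];L^p)` divergence free, `u₀ ∈ L^q`, `1/p + 1/q ≤ 1`, `u ∈ L^∞([0,T];L^q)`, tests
`φ ∈ C^∞_c([0,T) × T^d)`); Proposition 2.2 (existence of distributional solutions); **Definition 2.3**
(parabolic solution: additionally `u ∈ L²([0,T];H¹)`); **Proposition 2.4** (existence of a parabolic
solution for `b ∈ L¹_t L²_x`, `u₀ ∈ L²`); Lemma 2.6 (commutator estimate I); **Theorem 2.7** (uniqueness
of parabolic solutions for `b ∈ L²_t L²_x`); §3 "A regularity result": Lemma 3.1 (commutator estimate II,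
`L²_t H⁻¹_x`), **Theorem 3.3** (regularity: `b ∈ L²_t L^p_x`, `u ∈ L^∞_t L^q_x`, `1/p + 1/q ≤ 1/2` ⇒
parabolic, with the energy balance (3.4)), Remark 3.4, **Corollary 3.5** (uniqueness of distributional
solutions in that regime), questions (Q4)–(Q6).

## Contents

* `Torus.IsParabolicScalarSolutionOn T κ b θ₀ θ` — **Definition 2.3** (with a diffusivity `κ`, as in the
  tree's weak class; the source has `κ = 1`): a distributional solution with `∫₀ᵀ ‖∇θ(t)‖²_{L²} dt < ∞`.
* `BonicattoCiampaCrippa2024_prop24` — **Proposition 2.4** (named fact; `κ = 1`).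
* `BonicattoCiampaCrippa2024_thm27` — **Theorem 2.7** (named fact; `κ = 1`).
* `BonicattoCiampaCrippa2024_thm33` — **Theorem 3.3**, regularity clause (named fact; `κ = 1`).
* Proved: `Torus.IsWeakScalarTransportOn.isParabolicScalarSolutionOn_of_bounded` — the corner
  `p = ∞`, `q = 2` of Thm. 3.3 for every `κ > 0` (from the tree's `energy_ineq_holds`);
  `BonicattoCiampaCrippa2024_cor35_of` — **Corollary 3.5** from Thm. 3.3 and Thm. 2.7 (the source's
  one-line proof).

## Rendering and faithfulness notes

* The source fixes the diffusivity to `1` ("we consider a fixed diffusivity", §1); the three named facts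
  are typed with `κ = 1` exactly (the tree's weak class with `κ = 1`). The general-`κ > 0` versions follow
  by the time rescaling `t ↦ κt`, `b ↦ b/κ` (all integrability classes are invariant) but are NOT what is
  printed and are not vendored as facts — `TODO(general κ)`: derive them as theorems when a consumer needs
  them.
* `u ∈ L²([0,T];H¹(T^d))` for `u ∈ L^∞_t L²_x` is rendered as finiteness of `∫₀ᵀ ‖∇u(t)‖²_{L²} dt` with
  the spectral gradient norm `Torus.eScalarGradNormSq` (the `L²` part of the `H¹` norm is bounded on
  `(0,T)` already).
* `L^∞_t L^q_x` / `L²_t L^p_x` / `L¹_t L²_x` are ess-sup / lower-Lebesgue-integral conditions on the slices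
  (`eLpNorm (u t) q`, `eLpNorm (b t) p`), `p q : ℝ≥0∞` with `1 ≤ p`, `1 ≤ q` ("`p, q ≥ 1`", Thm. 3.3) and
  `p⁻¹ + q⁻¹ ≤ 2⁻¹`; on the probability space `T^d` these classes embed in the tree's standing
  `L^∞_t L²_x` / `L¹_t L²_x` classes, so "distributional solution" is the tree's weak class plus the
  extra integrability, stated as separate hypotheses.
* Thm. 3.3's energy balance (3.4) `½∫|u|² + ∫₀ᵀ∫|∇u|² = ½∫|u₀|²` is quoted in the docstring but not part
  of the typed conclusion (the time argument of the first term is implicit in print; the tree's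
  `IsWeakScalarTransportOn.lintegral_sq_add_le_holds` is the a.e.-in-time inequality form for bounded
  drifts); Prop. 2.2 (general `(p,q)` existence), Lemmas 2.6/3.1 (commutators) and (Q4)–(Q6) (open
  questions) are not typed.

## References

* P. Bonicatto, G. Ciampa, G. Crippa, J. Evol. Equ. 24 (2024) 1 = arXiv:2306.15529, §2–§3.
  [`BonicattoCiampaCrippa2023`]
* C. Le Bris, P.-L. Lions, Comm. PDE 33 (2008) ([LBL] of the source: Lemma 2.6, Thm. 2.7).
* R. J. DiPerna, P.-L. Lions, Invent. Math. 98 (1989). [`DiPernaLions1989`]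
-/

open MeasureTheory Set Filter
open scoped ENNReal NNReal Topology

noncomputable section

namespace Literature.Analysis.FluidPDE

open Literature.Analysis.FunctionSpaces

namespace Torus

variable {d : Type*} [Fintype d]

/-- **Parabolic solutions** (Bonicatto–Ciampa–Crippa 2024, Definition 2.3): a distributional solution
`θ ∈ L^∞([0,T];L²(T^d))` of `∂ₜθ + div(b θ) = κΔθ`, `θ(0) = θ₀` (the tree's `IsWeakScalarTransportOn T κ b θ₀ θ`,
the source's Def. 2.1 at `p = q = 2`, printed with `κ = 1`) which moreover lies in the *parabolic class*
`L²([0,T];H¹(T^d))`: `∫₀ᵀ ‖∇θ(t)‖²_{L²} dt < ∞` (spectral `eScalarGradNormSq`).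
[cite: BonicattoCiampaCrippa2023, Def. 2.3] -/
def IsParabolicScalarSolutionOn (T κ : ℝ) (b : ℝ → UnitAddTorus d → EuclideanSpace ℝ d)
    (θ₀ : UnitAddTorus d → ℝ) (θ : ℝ → UnitAddTorus d → ℝ) : Prop :=
  IsWeakScalarTransportOn T κ b θ₀ θ ∧ ∫⁻ t in Ioo 0 T, eScalarGradNormSq (θ t) < ∞

/-- A parabolic solution is a distributional (weak) solution. [cite: BonicattoCiampaCrippa2023, Def. 2.3] -/
theorem IsParabolicScalarSolutionOn.isWeakScalarTransportOn {T κ : ℝ}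
    {b : ℝ → UnitAddTorus d → EuclideanSpace ℝ d} {θ₀ : UnitAddTorus d → ℝ} {θ : ℝ → UnitAddTorus d → ℝ}
    (h : IsParabolicScalarSolutionOn T κ b θ₀ θ) : IsWeakScalarTransportOn T κ b θ₀ θ :=
  h.1

/-- **The corner `p = ∞`, `q = 2` of Thm. 3.3, for every `κ > 0`** (proved in the tree): for a bounded
drift `b ∈ L^∞((0,T) × T^d)` and an `L²` datum, EVERY weak solution in `L^∞_t L²_x` is parabolic, since
`2κ ∫₀ᵀ ‖∇θ‖² ≤ ‖θ₀‖²_{L²} < ∞` (`IsWeakScalarTransportOn.energy_ineq_holds`, whose docstring cites exactly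
Bonicatto–Ciampa–Crippa Thm. 3.3 with `p = ∞`, `q = 2`). [cite: BonicattoCiampaCrippa2023, Thm. 3.3 (case p = ∞, q = 2)] -/
theorem IsWeakScalarTransportOn.isParabolicScalarSolutionOn_of_bounded {T κ : ℝ} (hκ : 0 < κ)
    {b : ℝ → UnitAddTorus d → EuclideanSpace ℝ d} {θ₀ : UnitAddTorus d → ℝ} {θ : ℝ → UnitAddTorus d → ℝ}
    (h : IsWeakScalarTransportOn T κ b θ₀ θ) (hθ₀ : MemLp θ₀ 2 volume)
    (hb : MemLp (FunctionSpaces.Torus.stLift b) ∞ (volume.restrict (Ioo 0 T ×ˢ univ))) :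
    IsParabolicScalarSolutionOn T κ b θ₀ θ := by
  refine ⟨h, ?_⟩
  have hE := IsWeakScalarTransportOn.energy_ineq_holds hκ h hθ₀ hb
  -- `‖θ₀‖²_{L²} < ∞`
  have hfin : ∫⁻ x, ‖θ₀ x‖ₑ ^ 2 < ∞ := by
    have := hθ₀.eLpNorm_lt_top
    rw [← eLpNorm_two_pow_two_eq_lintegral]
    exact ENNReal.pow_lt_top this
  have h2 : eScalarDissipation κ θ 0 T < ∞ :=
    lt_of_le_of_lt (le_trans (le_mul_of_one_le_left bot_le (by norm_num)) hE) hfin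
  rw [eScalarDissipation] at h2
  have hκ' : ENNReal.ofReal κ ≠ 0 := by simpa using hκ
  exact lt_top_iff_ne_top.2 fun htop => (lt_top_iff_ne_top.1 h2) (by rw [htop]; exact ENNReal.mul_top hκ')

end Torus

/-! ## Named facts (Prop. 2.4, Thm. 2.7, Thm. 3.3) -/

/-- **Bonicatto–Ciampa–Crippa 2024, Proposition 2.4** (existence in the parabolic class), verbatim:
"Let `b ∈ L¹([0,T];L²(T^d))` be a divergence-free vector field and `u₀ ∈ L²(T^d)`. Then there exists at
least one parabolic solution." Typed with `κ = 1` (the source's diffusivity): for `T > 0`, a space–time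
measurable drift with `∫₀ᵀ ‖b(t)‖_{L²} dt < ∞`, weakly divergence free at a.e. time, and `θ₀ ∈ L²`,
there is a parabolic solution `IsParabolicScalarSolutionOn T 1 b θ₀ θ`. (For BOUNDED drifts and every
`κ > 0` the tree proves this: `exists_isWeakScalarTransportOn_holds` with
`IsWeakScalarTransportOn.isParabolicScalarSolutionOn_of_bounded`.) Proof in the source: regularise `b`
and `u₀`, energy balance (2.4), weak compactness. [cite: BonicattoCiampaCrippa2023, Prop. 2.4] -/
def BonicattoCiampaCrippa2024_prop24 : Prop :=
  ∀ (d : Type) [Fintype d] (T : ℝ), 0 < T →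
    ∀ (b : ℝ → UnitAddTorus d → EuclideanSpace ℝ d) (θ₀ : UnitAddTorus d → ℝ),
      AEStronglyMeasurable (FunctionSpaces.Torus.stLift b) (volume.restrict (Ioo 0 T ×ˢ univ)) →
      ∫⁻ t in Ioo 0 T, eLpNorm (b t) 2 volume < ∞ →
      (∀ᵐ t ∂(volume.restrict (Ioo 0 T)), FunctionSpaces.Torus.IsWeaklyDivFree (b t)) →
      MemLp θ₀ 2 volume →
      ∃ θ : ℝ → UnitAddTorus d → ℝ, Torus.IsParabolicScalarSolutionOn T 1 b θ₀ θ

/-- **Bonicatto–Ciampa–Crippa 2024, Theorem 2.7 (Uniqueness of parabolic solutions)**, verbatim: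
"Consider a divergence-free vector field `b ∈ L²([0,T];L²(T^d))`. Then there exists at most one parabolic
solution to (2.1)." Typed with `κ = 1`: for a drift with `∫₀ᵀ ‖b(t)‖²_{L²} dt < ∞` (divergence-freeness
at a.e. time is part of the weak class), two parabolic solutions from the same datum agree a.e. on
`(0,T) × T^d` (slice-wise a.e., for a.e. `t`). Proof in the source: the commutator
`r^δ = b·∇(w ⋆ ρ^δ) - (b·∇w) ⋆ ρ^δ → 0` in `L¹` for `∇w ∈ L²_t L²_x`, `b ∈ L²_t L²_x` (Lemma 2.6, after
Le Bris–Lions) and renormalisation with `β' = arctan`. Compare the tree's PROVED uniqueness theorems for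
Lipschitz drifts (`Torus.unique_of_lipschitz_holds`) and for `L¹_t Ḣ¹_x` drifts in the larger class
`L^∞_t L²_x` (`Torus.IsWeakScalarTransportOn.unique_of_lintegral_eGradNormSq_rpow_lt_top`): here NO
derivative of `b` is required, at the price of restricting to the parabolic class.
[cite: BonicattoCiampaCrippa2023, Thm. 2.7] -/
def BonicattoCiampaCrippa2024_thm27 : Prop :=
  ∀ (d : Type) [Fintype d] (T : ℝ) (b : ℝ → UnitAddTorus d → EuclideanSpace ℝ d) (θ₀ : UnitAddTorus d → ℝ)
    (θ₁ θ₂ : ℝ → UnitAddTorus d → ℝ),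
    ∫⁻ t in Ioo 0 T, eLpNorm (b t) 2 volume ^ 2 < ∞ →
    Torus.IsParabolicScalarSolutionOn T 1 b θ₀ θ₁ → Torus.IsParabolicScalarSolutionOn T 1 b θ₀ θ₂ →
    ∀ᵐ t ∂(volume.restrict (Ioo 0 T)), θ₁ t =ᵐ[volume] θ₂ t

/-- **Bonicatto–Ciampa–Crippa 2024, Theorem 3.3** (regularity of distributional solutions), verbatim:
"Let `p, q ≥ 1` such that `1/p + 1/q ≤ 1/2`. If `b ∈ L²([0,T];L^p(T^d))` is a divergence-free vector field
and `u ∈ L^∞([0,T];L^q(T^d))` is a distributional solution to (2.1), then `u ∈ L²([0,T];H¹(T^d))` and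
satisfies `½∫_{T^d} |u|² dx + ∫₀ᵀ∫_{T^d} |∇u|² dx dt = ½∫_{T^d} |u₀|² dx`. (3.4)" Typed with `κ = 1`, the
REGULARITY clause: for exponents `p q : ℝ≥0∞`, `1 ≤ p`, `1 ≤ q`, `p⁻¹ + q⁻¹ ≤ 2⁻¹`, a drift with
`∫₀ᵀ ‖b(t)‖²_{L^p} dt < ∞`, a datum `u₀ ∈ L^q` and a distributional solution (the tree's weak class) with
`ess sup_t ‖u(t)‖_{L^q} < ∞`, the solution is parabolic. The energy balance (3.4) is not part of the typed
conclusion (module docstring). The corner `p = ∞`, `q = 2` is PROVED in the tree for every `κ > 0`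
(`Torus.IsWeakScalarTransportOn.isParabolicScalarSolutionOn_of_bounded`). Proof in the source: the
commutator converges in `L²_t H⁻¹_x` (Lemma 3.1), uniform `L²_t H¹_x` bounds on the mollified solutions.
[cite: BonicattoCiampaCrippa2023, Thm. 3.3] -/
def BonicattoCiampaCrippa2024_thm33 : Prop :=
  ∀ (d : Type) [Fintype d] (T : ℝ) (p q : ℝ≥0∞), 1 ≤ p → 1 ≤ q → p⁻¹ + q⁻¹ ≤ 2⁻¹ →
    ∀ (b : ℝ → UnitAddTorus d → EuclideanSpace ℝ d) (θ₀ : UnitAddTorus d → ℝ) (θ : ℝ → UnitAddTorus d → ℝ),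
      ∫⁻ t in Ioo 0 T, eLpNorm (b t) p volume ^ 2 < ∞ →
      MemLp θ₀ q volume →
      (∃ C : ℝ≥0, ∀ᵐ t ∂(volume.restrict (Ioo 0 T)), eLpNorm (θ t) q volume ≤ C) →
      Torus.IsWeakScalarTransportOn T 1 b θ₀ θ →
      Torus.IsParabolicScalarSolutionOn T 1 b θ₀ θ

/-- **Bonicatto–Ciampa–Crippa 2024, Corollary 3.5** — "Combining Theorem 3.3 and Theorem 2.7", verbatim:
"Let `p, q ≥ 1` such that `1/p + 1/q ≤ 1/2`. If `b ∈ L²([0,T];L^p(T^d))` is a divergence-free vector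
field, then there exists at most one distributional solution `u ∈ L^∞([0,T];L^q(T^d))`." Proved from the
two named facts (`κ = 1`): both solutions are parabolic by Thm. 3.3, and `L²_t L^p_x ⊂ L²_t L²_x` on the
probability space `T^d` (`p ≥ 2` since `p⁻¹ ≤ 2⁻¹`) feeds Thm. 2.7.
[cite: BonicattoCiampaCrippa2023, Cor. 3.5] -/
theorem BonicattoCiampaCrippa2024_cor35_of (h33 : BonicattoCiampaCrippa2024_thm33)
    (h27 : BonicattoCiampaCrippa2024_thm27) :
    ∀ (d : Type) [Fintype d] (T : ℝ) (p q : ℝ≥0∞), 1 ≤ p → 1 ≤ q → p⁻¹ + q⁻¹ ≤ 2⁻¹ →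
      ∀ (b : ℝ → UnitAddTorus d → EuclideanSpace ℝ d) (θ₀ : UnitAddTorus d → ℝ)
        (θ₁ θ₂ : ℝ → UnitAddTorus d → ℝ),
        ∫⁻ t in Ioo 0 T, eLpNorm (b t) p volume ^ 2 < ∞ →
        MemLp θ₀ q volume →
        (∃ C : ℝ≥0, ∀ᵐ t ∂(volume.restrict (Ioo 0 T)), eLpNorm (θ₁ t) q volume ≤ C) →
        (∃ C : ℝ≥0, ∀ᵐ t ∂(volume.restrict (Ioo 0 T)), eLpNorm (θ₂ t) q volume ≤ C) →
        Torus.IsWeakScalarTransportOn T 1 b θ₀ θ₁ → Torus.IsWeakScalarTransportOn T 1 b θ₀ θ₂ →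
        ∀ᵐ t ∂(volume.restrict (Ioo 0 T)), θ₁ t =ᵐ[volume] θ₂ t := by
  intro d _ T p q hp hq hpq b θ₀ θ₁ θ₂ hb hθ₀ hC₁ hC₂ h₁ h₂
  have hP₁ := h33 d T p q hp hq hpq b θ₀ θ₁ hb hθ₀ hC₁ h₁
  have hP₂ := h33 d T p q hp hq hpq b θ₀ θ₂ hb hθ₀ hC₂ h₂
  -- `p ≥ 2`, so `‖b(t)‖_{L²} ≤ ‖b(t)‖_{L^p}` on the probability space `T^d`
  have hp2 : (2 : ℝ≥0∞) ≤ p := by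
    have : p⁻¹ ≤ 2⁻¹ := le_trans (le_self_add) hpq
    exact ENNReal.inv_le_inv.1 this
  have hb2 : ∫⁻ t in Ioo 0 T, eLpNorm (b t) 2 volume ^ 2 < ∞ := by
    refine lt_of_le_of_lt (lintegral_mono_ae ?_) hb
    filter_upwards [h₁.ae_aestronglyMeasurable_velocity_slice] with t ht
    gcongr
    exact eLpNorm_le_eLpNorm_of_exponent_le hp2 ht
  exact h27 d T b θ₀ θ₁ θ₂ hb2 hP₁ hP₂

end Literature.Analysis.FluidPDE

end
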